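import Mathlib
import HarnessLib
import Summits.HubbardSuperconductivity.HubbardSuperconductivity.Theorems.KLProgrammeKLRegimeEngineTowerBookkeepingProfileTok
import Summits.HubbardSuperconductivity.HubbardSuperconductivity.Theorems.KLProgrammeKLRegimeEngineTowerModelDefsWtPowAt
import Summits.HubbardSuperconductivity.HubbardSuperconductivity.Theorems.KLProgrammeKLRegimeEngineTowerLevFloorUnitsDefs

/-!
# Route `KLProgramme` — crux K3 ENGINE (stmt-HubbardSuperconductivity-20437 `KLRegimeEngineV17F2`), stub (b) / E1 interface (E2) in-tower route and located risk #17
# «(C2)-MOMENTS»: W1 AT WEIGHT POWER `Dw` — THE RE-BASED ONE-TRACK DEGREE-`Dw` WEIGHTED TOWER LAW FROM NAMED INPUTS, TOKEN CARRIED, PROFILE ROWS EXPORTED;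
# the power-`Dw` twin of `…EngineTowerWtLawBaseTokX` (M1-tokX on the carriers `klTowerBornWtPowAt / klTowerMeasWtPowAt` of ✓ …TowerModelDefsWtPowAt)
# (recipe «(E2)-POW3-TRACK» item T6 «law», HOME/hubbard-kl-k3c3-p2/g19/E2-POW3-TRACK-RECIPE.md; pen g27 (R472)(D), (R479) «LINK/LAW twins»;
#  cell gate-hubbard-kl, seat hubbard-kl-k3c3-p2 g20)

WHY.  The (E2) in-tower production route (k3c2-p3 E2-CELL-READER rev 4 §6, this lineage's recipe §2) and #17-Z (row (X).3) read, per block `k′`, the degree-`Dw`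
(`(1 + Λ_j·diam)^{Dw}`-weighted, `Dw = 3` resp. `5`) born sizes of the increments `Δ_{k′}`; the degree-`Dw` doors (`klWtPinnedSumPow_klTowerIncr_le`, ✓ …TowerBlockIncrWtPowAt)
read the degree-`Dw` measured sizes of the block input `𝒱_{dk}` in EVERY degree, so the track is a full parallel degree-`Dw` tower whose irrelevant part (degrees `2p ≥ 6`)
must close under a law exactly as the degree-1 weighted track (ℓ)/(b)-WT4 does.  This file is that law's generic layer M1 — the degree-1 file VERBATIM on the degree-`Dw`
arrays (the weights are dimensionless; the kit's `towerFO/towerS/towerV` arithmetic is weight-blind), an instance of `towerBorn_le_law_tracks_of_profile_base_tok`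
(…BookkeepingProfileTok §2) with ONE track:

* arrays (inline): born `klTowerBornWtPowAt … d (k−1) j Dw (2p) / klLevUnitF β M 0 p (d(k−1))` (block `k ≥ 1` ↦ `Δ_{k−1}` at `F_{d(k−1)}`, rate `j`), measured
  `W·Z^m·klTowerMeasWtPowAt … d k j Dw (2m) / klLevUnitF β M 0 m (dk−1)` (input `𝒱_{dk}` at `F_{dk−1}`, rate `j`; `W, Z ≥ 0` the LINK's scalings, ✓ …TowerWtPowStepLinkUniform);
* **`klTowerBornWtPowAt_le_law_of_inputs_base_tokX (j d Kb D Dw)`** — NAMED inputs: the block-`1` measured profile `hbase` (degrees `8 ≤ 2m ≤ 2D`), the re-based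
  re-measurement BRIDGE `hR` at blocks `2 ≤ k ≤ K_b`, the three IMPORTS `ι₁ ι₂ ι₃` (degrees `2, 4, 6`) at every block `1 ≤ k ≤ K_b` (the two-leg measured input of a block
  stays an import — (E2) at level `dk−1` — exactly as `ι₁` in the degree-1 law: recipe T6), the token `Zk` (`hZ1`, `hZsucc`), the degree-`Dw` STEP at blocks `1 ≤ k < K_b`
  in the kit's literal form (W2 `wtPowLaw_hstep_of_blockBounds` serves it), and the kit's numerics verbatim ⊢
  `(∀ k, 1 ≤ k ≤ K_b → Zk k) ∧ (∀ k, 2 ≤ k ≤ K_b, ∀ 3 ≤ p ≤ D, born ≤ Aλ^{p−1}Q^p) ∧ (∀ k, 1 ≤ k ≤ K_b, ∀ 4 ≤ m ≤ D, measured ≤ A′λ^{m−1}Q′^m)` — the last conjunct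
  EXPORTS the measured profile rows of every block, which the two-leg tadpole-free export (…TowerWtPowTwoLegExport) and the read-out consume.
No model hypothesis is needed or assumed; the rate index `j`, the weight power `Dw`, the frame `K` and the block length `d` are free.
Composition of a landed theorem; nothing about the model is asserted; nothing asserts (E2), (X).3, (b), any stub, K3 or superconductivity.
References: BGM 2006 §2.8 (2.83), (2.93)–(2.98), §3 (3.2)–(3.8) [cite: BenfattoGiulianiMastropietro2006].
-/

noncomputable section

namespace Summit.HubbardSuperconductivity.HubbardSuperconductivity.Theorems.EngineV8

set_option linter.dupNamespace false -- summit = problem name (single-conjunct summit), D-0017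

open Classical
open Real Finset Literature.MathematicalPhysics.QuantumLattice Literature.Probability.LatticeModels GrassmannAlgebra
open Literature.MathematicalPhysics.QuantumLattice.FermiRG
open Summit.HubbardSuperconductivity.HubbardSuperconductivity.Theorems.KLProgrammeLegKernels
open Summit.HubbardSuperconductivity.HubbardSuperconductivity.Theorems.KLRegimeSplit
open Summit.HubbardSuperconductivity.HubbardSuperconductivity.Theorems.DispersionFlow

variable {L M : ℕ} [NeZero L] [NeZero M]

/-! ## §1 Nonnegativity of the degree-`Dw` weighted arrays in units -/

/-- The measured degree-`Dw` weighted array in units, scaled by `W·Z^m ≥ 0`, is nonnegative (`0 < β`). [cite: BenfattoGiulianiMastropietro2006, §3 (3.5)-(3.6)] -/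
theorem towerMuWtPow_nonneg {β : ℝ} (hβ : 0 < β) (U μ : ℝ) (K : TrigPolyC4v) (d k j Dw m : ℕ) {W Z : ℝ} (hW : 0 ≤ W) (hZ : 0 ≤ Z) :
    0 ≤ W * Z ^ m * (klTowerMeasWtPowAt L M β U μ K d k j Dw (2 * m) / klLevUnitF β M 0 m (d * k - 1)) :=
  mul_nonneg (by positivity) (div_nonneg (klTowerMeasWtPowAt_nonneg hβ.le U μ K d k j Dw (2 * m)) (klLevUnitF_pos hβ 0 m (d * k - 1)).le)

/-- The born degree-`Dw` weighted array in units is nonnegative (`0 < β`). [cite: BenfattoGiulianiMastropietro2006, §3 (3.5)-(3.6)] -/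
theorem towerBWtPow_nonneg {β : ℝ} (hβ : 0 < β) (U μ : ℝ) (K : TrigPolyC4v) (d k j Dw p : ℕ) :
    0 ≤ klTowerBornWtPowAt L M β U μ K d k j Dw (2 * p) / klLevUnitF β M 0 p (d * k) :=
  div_nonneg (klTowerBornWtPowAt_nonneg hβ.le U μ K d k j Dw (2 * p)) (klLevUnitF_pos hβ 0 p (d * k)).le

/-! ## §2 W1 at weight power `Dw`: the re-based one-track law from named inputs, token carried, profile rows exported -/

/-- **THE RE-BASED ONE-TRACK DEGREE-`Dw` WEIGHTED TOWER LAW FROM NAMED INPUTS, TOKEN CARRIED, PROFILE ROWS EXPORTED** (power-`Dw` twin of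
`klTowerBornWtAt_le_law_of_inputs_base_tokX`; rate index `j`, weight power `Dw`, frame `K`, block length `d` free).  Arrays: born
`klTowerBornWtPowAt … d (k−1) j Dw (2p) / klLevUnitF β M 0 p (d(k−1))`, measured `W·Z^m·klTowerMeasWtPowAt … d k j Dw (2m) / klLevUnitF β M 0 m (dk−1)`.  Given the block-`1`
profile `hbase`, the re-measurement bridge `hR` at the blocks `2 ≤ k ≤ K_b`, the imports `ι₁ ι₂ ι₃` (degrees `2, 4, 6`) at every block `1 ≤ k ≤ K_b`, the token (`hZ1`, `hZsucc`),
the step at the blocks `1 ≤ k < K_b` and the kit's numerics: the token holds at every block `1 ≤ k ≤ K_b`, the born arrays of the blocks `2 ≤ k ≤ K_b` obey `Aλ^{p−1}Q^p`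
(`3 ≤ p ≤ D`), and the measured profile rows `≤ A′λ^{m−1}Q′^m` (`4 ≤ m ≤ D`) hold at every block `1 ≤ k ≤ K_b`. [cite: BenfattoGiulianiMastropietro2006, §2.8 (2.83), (2.93)-(2.98)] -/
theorem klTowerBornWtPowAt_le_law_of_inputs_base_tokX {β : ℝ} (hβ : 0 < β) (U μ : ℝ) (K : TrigPolyC4v)
    (j d Kb D Dw : ℕ) {A lam Q W Z A' Q' σ Φ ψ τ ι₁ ι₂ ι₃ : ℝ} {Zk : ℕ → Prop} (hD3 : 3 ≤ D)
    (hA : 0 ≤ A) (hlam : 0 < lam) (hQ : 0 ≤ Q) (hW : 0 ≤ W) (hZ : 0 ≤ Z) (hA'0 : 0 ≤ A') (hQ'0 : 0 < Q')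
    (hσ : 0 ≤ σ) (hΦ : 0 ≤ Φ) (hψ : 0 ≤ ψ) (hτ : 0 < τ)
    -- the base profile at block 1 (`𝒱_d` at `F_{d−1}`, rate `j`, weight power `Dw`)
    (hbase : ∀ m, 4 ≤ m → m ≤ D →
      W * Z ^ m * (klTowerMeasWtPowAt L M β U μ K d 1 j Dw (2 * m) / klLevUnitF β M 0 m (d * 1 - 1)) ≤ A' * lam ^ (m - 1) * Q' ^ m)
    -- the re-based re-measurement bridge at blocks 2 ≤ k ≤ Kb
    (hR : ∀ k, 2 ≤ k → k ≤ Kb →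
      (∀ k', 2 ≤ k' → k' ≤ k → ∀ p, 3 ≤ p → p ≤ D →
        klTowerBornWtPowAt L M β U μ K d (k' - 1) j Dw (2 * p) / klLevUnitF β M 0 p (d * (k' - 1)) ≤ A * lam ^ (p - 1) * Q ^ p) →
      ∀ m, 4 ≤ m → m ≤ D →
        W * Z ^ m * (klTowerMeasWtPowAt L M β U μ K d k j Dw (2 * m) / klLevUnitF β M 0 m (d * k - 1)) ≤ A' * lam ^ (m - 1) * Q' ^ m)
    -- the weighted imports (degrees 2, 4, 6) at every block 1 ≤ k ≤ Kb
    (hι₁ : ∀ k, 1 ≤ k → k ≤ Kb → W * Z ^ 1 * (klTowerMeasWtPowAt L M β U μ K d k j Dw (2 * 1) / klLevUnitF β M 0 1 (d * k - 1)) ≤ ι₁ * lam)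
    (hι₂ : ∀ k, 1 ≤ k → k ≤ Kb → W * Z ^ 2 * (klTowerMeasWtPowAt L M β U μ K d k j Dw (2 * 2) / klLevUnitF β M 0 2 (d * k - 1)) ≤ ι₂ * lam)
    (hι₃ : ∀ k, 1 ≤ k → k ≤ Kb → W * Z ^ 3 * (klTowerMeasWtPowAt L M β U μ K d k j Dw (2 * 3) / klLevUnitF β M 0 3 (d * k - 1)) ≤ ι₃ * lam ^ 2)
    -- the token along the blocks («(ℓ)-Z-THREAD»): base, and propagation under the step's guard
    (hZ1 : Zk 1)
    (hZsucc : ∀ k, 1 ≤ k → k < Kb → Zk k →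
      Φ * towerV D τ (fun m => W * Z ^ m * (klTowerMeasWtPowAt L M β U μ K d k j Dw (2 * m) / klLevUnitF β M 0 m (d * k - 1))) < 1 → Zk (k + 1))
    -- the degree-`Dw` weighted step at blocks 1 ≤ k < Kb (W2's LINK), which may use the token at its own block
    (hstep : ∀ k, 1 ≤ k → k < Kb → Zk k → ∀ N : ℕ, 2 ≤ N → ∀ p, 3 ≤ p → p ≤ D →
      Φ * towerV D τ (fun m => W * Z ^ m * (klTowerMeasWtPowAt L M β U μ K d k j Dw (2 * m) / klLevUnitF β M 0 m (d * k - 1))) < 1 →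
      klTowerBornWtPowAt L M β U μ K d k j Dw (2 * p) / klLevUnitF β M 0 p (d * k) ≤
        towerFO D σ (fun m => W * Z ^ m * (klTowerMeasWtPowAt L M β U μ K d k j Dw (2 * m) / klLevUnitF β M 0 m (d * k - 1))) p +
          ∑ n ∈ Icc 2 N, exp 1 * Φ ^ (n - 1) * ψ ^ p *
            towerS D τ (fun m => W * Z ^ m * (klTowerMeasWtPowAt L M β U μ K d k j Dw (2 * m) / klLevUnitF β M 0 m (d * k - 1))) n p +
          ψ ^ p * exp 1 * towerV D τ (fun m => W * Z ^ m * (klTowerMeasWtPowAt L M β U μ K d k j Dw (2 * m) / klLevUnitF β M 0 m (d * k - 1))) *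
            (Φ * towerV D τ (fun m => W * Z ^ m * (klTowerMeasWtPowAt L M β U μ K d k j Dw (2 * m) / klLevUnitF β M 0 m (d * k - 1)))) ^ N /
            (1 - Φ * towerV D τ (fun m => W * Z ^ m * (klTowerMeasWtPowAt L M β U μ K d k j Dw (2 * m) / klLevUnitF β M 0 m (d * k - 1)))))
    -- the kit's numerics
    (hx₁ : 4 * σ * lam * Q' < 1) (hx₂ : 2 * lam * τ * Q' ≤ 1) (hx₃ : exp 1 * τ * lam * Q' < 1)
    (hy : Φ * (τ * (ι₁ * lam + ι₂ / (2 * Q') + ι₃ / (4 * Q' ^ 2) + A' * Q' / 4)) < 1)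
    (hθ : Φ * (exp 1 * τ * (ι₁ * lam) + (exp 1 * τ) ^ 2 * (ι₂ * lam) + (exp 1 * τ) ^ 3 * (ι₃ * lam ^ 2) +
      A' * (exp 1 * τ * Q') * ((exp 1 * τ * lam * Q') ^ 3 / (1 - exp 1 * τ * lam * Q'))) < 1)
    (hu₁ : 4 * Q' ≤ Q) (hu₂ : 2 * τ * ψ * Q' ≤ Q)
    (hclose : A' * (4 * Q') ^ 3 * (4 * σ * lam * Q' / (1 - 4 * σ * lam * Q')) +
      exp 1 * ψ * (2 * τ * ψ * Q') ^ 2 * (τ * (ι₁ * lam + ι₂ / (2 * Q') + ι₃ / (4 * Q' ^ 2) + A' * Q' / 4)) *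
        (Φ * (τ * (ι₁ * lam + ι₂ / (2 * Q') + ι₃ / (4 * Q' ^ 2) + A' * Q' / 4)) /
          (1 - Φ * (τ * (ι₁ * lam + ι₂ / (2 * Q') + ι₃ / (4 * Q' ^ 2) + A' * Q' / 4)))) ≤ A * Q ^ 3) :
    (∀ k, 1 ≤ k → k ≤ Kb → Zk k) ∧
    (∀ k, 2 ≤ k → k ≤ Kb → ∀ p : ℕ, 3 ≤ p → p ≤ D →
      klTowerBornWtPowAt L M β U μ K d (k - 1) j Dw (2 * p) / klLevUnitF β M 0 p (d * (k - 1)) ≤ A * lam ^ (p - 1) * Q ^ p) ∧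
    (∀ k, 1 ≤ k → k ≤ Kb → ∀ m, 4 ≤ m → m ≤ D →
      W * Z ^ m * (klTowerMeasWtPowAt L M β U μ K d k j Dw (2 * m) / klLevUnitF β M 0 m (d * k - 1)) ≤ A' * lam ^ (m - 1) * Q' ^ m) := by
  -- the inline arrays
  set b : Unit → ℕ → ℕ → ℝ := fun _ k p => klTowerBornWtPowAt L M β U μ K d (k - 1) j Dw (2 * p) / klLevUnitF β M 0 p (d * (k - 1)) with hb
  set μw : ℕ → ℕ → ℝ := fun k m => W * Z ^ m * (klTowerMeasWtPowAt L M β U μ K d k j Dw (2 * m) / klLevUnitF β M 0 m (d * k - 1)) with hμw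
  have hprof : ∀ k, 1 ≤ k → k < Kb →
      (∀ k', 2 ≤ k' → k' ≤ k → ∀ t : Unit, ∀ p, 3 ≤ p → p ≤ D → b t k' p ≤ A * lam ^ (p - 1) * Q ^ p) →
      ∀ m, 4 ≤ m → m ≤ D → μw k m ≤ A' * lam ^ (m - 1) * Q' ^ m := by
    intro k hk1 hkK ih m hm hmD
    rcases Nat.lt_or_ge k 2 with hk | hk
    · obtain rfl : k = 1 := by omega
      exact hbase m hm hmD
    · exact hR k hk hkK.le (fun k' hk'2 hk'le p hp hpD => ih k' hk'2 hk'le () p hp hpD) m hm hmD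
  have hprof3 : ∀ k, 1 ≤ k → k < Kb → 3 ≤ D →
      (∀ k', 2 ≤ k' → k' ≤ k → ∀ t : Unit, ∀ p, 3 ≤ p → p ≤ D → b t k' p ≤ A * lam ^ (p - 1) * Q ^ p) →
      μw k 3 ≤ ι₃ * lam ^ 2 :=
    fun k hk1 hkK _ _ => hι₃ k hk1 hkK.le
  have hstep' : ∀ t : Unit, ∀ k, 1 ≤ k → k < Kb → Zk k → ∀ N : ℕ, 2 ≤ N → ∀ p, 3 ≤ p → p ≤ D → Φ * towerV D τ (μw k) < 1 →
      b t (k + 1) p ≤ towerFO D σ (μw k) p + ∑ n ∈ Icc 2 N, exp 1 * Φ ^ (n - 1) * ψ ^ p * towerS D τ (μw k) n p +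
        ψ ^ p * exp 1 * towerV D τ (μw k) * (Φ * towerV D τ (μw k)) ^ N / (1 - Φ * towerV D τ (μw k)) := by
    intro _ k hk1 hkK hZk N hN p hp hpD hguard
    have hbk : b () (k + 1) p = klTowerBornWtPowAt L M β U μ K d k j Dw (2 * p) / klLevUnitF β M 0 p (d * k) := by
      simp only [hb, Nat.add_sub_cancel]
    rw [hbk]
    exact hstep k hk1 hkK hZk N hN p hp hpD hguard
  obtain ⟨hZall, hlaw⟩ := towerBorn_le_law_tracks_of_profile_base_tok (T := Unit) (K := Kb) (D := D) (b := b) (μ := μw)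
    (A := A) (lam := lam) (Q := Q) (A' := A') (Q' := Q') (ι₁ := ι₁) (ι₂ := ι₂) (ι₃ := ι₃) (Zk := Zk) hD3 hlam hA hQ hσ hΦ hψ hτ hQ'0 hA'0
    (fun k _ m => towerMuWtPow_nonneg hβ U μ K d k j Dw m hW hZ) hZ1 hZsucc hprof hprof3
    (fun k hk1 hkK => hι₁ k hk1 hkK.le) (fun k hk1 hkK => hι₂ k hk1 hkK.le) hstep' hx₁ hx₂ hx₃ hy hθ hu₁ hu₂ hclose
  refine ⟨hZall, fun k hk2 hkK p hp hpD => hlaw k hk2 hkK () p hp hpD, fun k hk1 hkK m hm hmD => ?_⟩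
  rcases Nat.lt_or_ge k 2 with hk | hk
  · obtain rfl : k = 1 := by omega
    exact hbase m hm hmD
  · exact hR k hk hkK (fun k' hk'2 hk'le p hp hpD => hlaw k' hk'2 (hk'le.trans hkK) () p hp hpD) m hm hmD

end Summit.HubbardSuperconductivity.HubbardSuperconductivity.Theorems.EngineV8

end
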